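import Mathlib
import Literature.NumberTheory.LFunctions.Zhang2022.KnifeEdgeBandScaleFlat
import Literature.NumberTheory.LFunctions.Zhang2022.RepairRplusSmoothLengths

/-!
# Zhang (2022) §18-margin repair rung — barrier extension `R⁺⁺`: the SMOOTH CLASS (`K`-Lipschitz, `‖·‖ ≤ M` on `[1,∞)`
# only) FROM THE TRUE BAND EDGE — band-scale invisibility for the class and the rows `familySmoothBandEdge`,
# `familySmoothTopBandEdge` (no slot, no fixed `ε`, saving `𝓛^{−A}`)

Trunk T-ANT (NumberTheory/LFunctions). Y. Zhang, *Discrete mean estimates and the Landau–Siegel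
zero*, arXiv:2211.02515v1 (2022) [Zhang2022LandauSiegel] — **an unrefereed manuscript under
adjudication. WHAT THIS IS NOT: nothing here asserts or denies its Theorems 1–2 or any analytic lemma;
no claim about Landau–Siegel zeros, about Parity, or about a repaired `Margin232` is made.** Cell `landau-siegel`
(rung F-S3), sub-cell E, seat ls-barrier-p2 g2.

`tailInvisible_bandScale` (p469201) / `discMeanFlat_bandEdge` (p469409) are stated for GLOBALLY 1-Lipschitz profiles with
`‖g‖ ≤ 1`; the barrier's smooth rows (`familySmoothLengths`/`familySmoothTop`, p457377; the glued two-piece profiles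
`u ⊕ v` of `Repair.inClass_glue`, p458054) only ask `K`-Lipschitz and `‖·‖ ≤ M` ON `[1, ∞)` (anything `H¹` below the
wall). Since the band edge `D·P·𝓛^m` lies beyond `P` (`z ≥ 1`), the modification `z ↦ c⁻¹·g(max z 1)`, `c = max(K,M)`,
is globally 1-Lipschitz, bounded by `1`, and agrees with `c⁻¹g` on every block beyond the edge — so the class version
follows (as `KnifeEdgeSmoothClass.tailInvisible_lipschitzOn` followed from `tailInvisible`, p456650):

* `tailInvisible_bandScale_lipschitzOn`: `‖Σ_{X<n≤Y} χψ(n)g(z_n)n^{−s}‖ ≤ C·max(K,M)·𝓛^{−A}` for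
  `D·P·𝓛^{1056+2A} ≤ X ≤ Y ≤ P^{1+δ}`; `tailInvisible_bandScale_sampled_lipschitzOn` (at sampled zeros, `Re ρ = ½`
  displayed); `discMeanFlat_bandEdge_lipschitzOn`:
  `|discMean(N₂) − discMean(N₁)| ≤ 𝓛^{−A}·(discMeanAbs(N₁) + max(K,M)²·discWeight)` for
  `⌈D·P·𝓛^{1058+2A}⌉ + 1 ≤ N₁ ≤ N₂ ≤ ⌈P^{1+δ}⌉`; `discMeanFlat_bandEdge_topVanishing`: the same for EVERY `N₂ ≥ N₁` when
  `g = 0` on `[θ, ∞)`, `θ ≤ 1 + δ`.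
* rows `Repair.familySmoothBandEdge` (Design/InClass = `SmoothDesign` of p457377 UNCHANGED; Verdict from the band edge,
  every `δ > 0`, every `A`) and `Repair.familySmoothTopBandEdge` (`SmoothTopDesign`; full polynomial), `_decided`,
  `rplus_smoothBandEdge_decided`; C2: same classes as `familySmoothLengths`/`familySmoothTop` (by `Iff.rfl`), so their
  C4 witnesses (`inClass_flat`, `inClass_phiTop`, `inClass_glue`) are members by name.
* With the units lemma (`discWeight ≤ 3𝓛⁹𝔓`, p467613) every verdict here is an `o(𝔞𝔓)` statement for `A ≥ 10`: no
  MAIN-ORDER length gain from the true band edge `z = 1 + α̃ + O(log𝓛/𝓛⁹)` on, for the whole smooth class.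

CURRENCY (REF-E C3(e)): discrete mean over the sampled zeros; (b) `Re ρ = ½` displayed; NO (c)-slot.

## References

* Y. Zhang, arXiv:2211.02515v1 (2022), §2 (2.14)–(2.20), (2.30), §7 (7.2) [p. 44], §8 Lemma 8.1.
  [cite: Zhang2022LandauSiegel, §§2, 7, 8]
* H. L. Montgomery, R. C. Vaughan, *Multiplicative Number Theory I*, Thm 9.18. [cite: MontgomeryVaughan2007, Thm 9.18]
-/

noncomputable section

open Complex Real Finset
open scoped NNReal

namespace Literature.NumberTheory.LFunctions.Zhang2022.KnifeEdgeInvisibleTail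

open Skeleton

/-! ### Bookkeeping -/

/-- `L ≤ log D` once `⌈e^L⌉ ≤ D`. [folklore] -/
private theorem le_ell_of_ceil_exp_le₄ {L₀ : ℝ} {D : ℕ} (hD : ⌈Real.exp L₀⌉₊ ≤ D) : L₀ ≤ ell D := by
  have h : Real.exp L₀ ≤ (D : ℝ) := (Nat.le_ceil _).trans (by exact_mod_cast hD)
  exact (Real.le_log_iff_exp_le (lt_of_lt_of_le (Real.exp_pos _) h)).mpr h

/-- Normalising a profile that is `K`-Lipschitz on `S` with `‖g‖ ≤ M` there by `c ≥ max(K, M)`, `c > 0`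
(copy of the private helper of `KnifeEdgeSmoothClassTail`). [folklore] -/
private theorem lipschitzOn_normalise' {g : ℝ → ℂ} {K : ℝ≥0} {M : ℝ} {S : Set ℝ} (hg : LipschitzOnWith K g S)
    (hM : ∀ z ∈ S, ‖g z‖ ≤ M) {c : ℝ} (hKc : (K : ℝ) ≤ c) (hMc : M ≤ c) (hc : 0 < c) :
    LipschitzOnWith 1 (fun z => ((c⁻¹ : ℝ) : ℂ) * g z) S ∧ ∀ z ∈ S, ‖((c⁻¹ : ℝ) : ℂ) * g z‖ ≤ 1 := by
  have hcinv : ‖((c⁻¹ : ℝ) : ℂ)‖ = c⁻¹ := by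
    rw [Complex.norm_real, Real.norm_of_nonneg (inv_nonneg.mpr hc.le)]
  refine ⟨lipschitzOnWith_iff_dist_le_mul.mpr fun a ha b hb => ?_, fun z hz => ?_⟩
  · rw [dist_eq_norm, ← mul_sub, norm_mul, hcinv, ← dist_eq_norm, NNReal.coe_one, one_mul]
    have h1 := lipschitzOnWith_iff_dist_le_mul.mp hg a ha b hb
    calc c⁻¹ * dist (g a) (g b) ≤ c⁻¹ * (K * dist a b) :=
          mul_le_mul_of_nonneg_left h1 (inv_nonneg.mpr hc.le)
      _ ≤ c⁻¹ * (c * dist a b) :=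
          mul_le_mul_of_nonneg_left (mul_le_mul_of_nonneg_right hKc dist_nonneg) (inv_nonneg.mpr hc.le)
      _ = dist a b := by field_simp
  · rw [norm_mul, hcinv]
    calc c⁻¹ * ‖g z‖ ≤ c⁻¹ * c := mul_le_mul_of_nonneg_left ((hM z hz).trans hMc) (inv_nonneg.mpr hc.le)
      _ = 1 := inv_mul_cancel₀ hc.ne'

/-- The global modification `z ↦ h(max z 1)` of a profile `h` that is 1-Lipschitz with `‖h‖ ≤ 1` on `[1, ∞)` is
globally 1-Lipschitz with `‖·‖ ≤ 1`. [folklore] -/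
private theorem maxOne_modification {h : ℝ → ℂ} (hh : LipschitzOnWith 1 h (Set.Ici 1))
    (hh1 : ∀ z ∈ Set.Ici (1:ℝ), ‖h z‖ ≤ 1) :
    LipschitzWith 1 (fun z => h (max z 1)) ∧ ∀ z, ‖h (max z 1)‖ ≤ 1 := by
  refine ⟨LipschitzWith.mk_one fun z₁ z₂ => ?_, fun z => hh1 _ (Set.mem_Ici.mpr (le_max_right _ _))⟩
  have h1 : dist (max z₁ 1) (max z₂ 1) ≤ dist z₁ z₂ := by
    have := lipschitzWith_iff_dist_le_mul.mp (LipschitzWith.id.max_const (1:ℝ)) z₁ z₂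
    simpa using this
  have h2 := lipschitzOnWith_iff_dist_le_mul.mp hh (max z₁ 1) (Set.mem_Ici.mpr (le_max_right _ _))
    (max z₂ 1) (Set.mem_Ici.mpr (le_max_right _ _))
  calc dist (h (max z₁ 1)) (h (max z₂ 1)) ≤ (1 : NNReal) * dist (max z₁ 1) (max z₂ 1) := h2
    _ ≤ dist z₁ z₂ := by rw [NNReal.coe_one, one_mul]; exact h1

/-! ### The band-scale invisible tail for the class `K`-Lipschitz, `‖·‖ ≤ M` on `[1, ∞)` -/

/-- **Band-scale invisible tail for profiles `K`-Lipschitz and bounded by `M` on `[1, ∞)` ONLY** (`0 < δ`, `A : ℕ`):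
there is `C > 0` such that for all large `D`, every primitive quadratic `χ (mod D)`, every member `x` of the family,
every such `g`, every `s` with `½ − 1/log P ≤ Re s ≤ 2`, `|Im s| ≤ 8t₀`, and every block
`D·P·𝓛^{1056+2A} ≤ X ≤ Y ≤ P^{1+δ}`: `‖Σ_{X<n≤Y} χψ(n) g(log n/log P) n^{−s}‖ ≤ C·max(K,M)·𝓛^{−A}`.
[cite: MontgomeryVaughan2007, Thm 9.18] [cite: Zhang2022LandauSiegel, §2 (2.30); §7 (7.2)] -/
theorem tailInvisible_bandScale_lipschitzOn {δ : ℝ} (hδ : 0 < δ) (A : ℕ) :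
    ∃ C : ℝ, 0 < C ∧ Skeleton.ForAllLarge fun D _ χ =>
      ∀ (x : Skeleton.Chr D) (g : ℝ → ℂ) (K : ℝ≥0) (M : ℝ), LipschitzOnWith K g (Set.Ici 1) →
          (∀ z : ℝ, 1 ≤ z → ‖g z‖ ≤ M) →
        ∀ s : ℂ, 1 / 2 - 1 / Real.log (Skeleton.bigP D) ≤ s.re → s.re ≤ 2 → |s.im| ≤ 8 * Skeleton.t0 D →
          ∀ X Y : ℕ, (D : ℝ) * Skeleton.bigP D * Skeleton.ell D ^ (1056 + 2 * A) ≤ (X : ℝ) → X ≤ Y →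
            (Y : ℝ) ≤ Skeleton.bigP D ^ (1 + δ) →
            ‖∑ n ∈ Finset.Ioc X Y, Skeleton.pc χ x n * g (Real.log n / Real.log (Skeleton.bigP D)) *
                (n : ℂ) ^ (-s)‖ ≤ C * max (K : ℝ) M * (Skeleton.ell D ^ A)⁻¹ := by
  obtain ⟨C, hC, D₀, hT⟩ := tailInvisible_bandScale hδ A
  refine ⟨C, hC, max D₀ 3, ?_⟩
  intro D _ χ hD hquad hprim x g K M hg hM s hσ1 hσ2 hsim X Y hX hXY hY
  have hT' := hT D χ (le_trans (le_max_left _ _) hD) hquad hprim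
  have hD3 : 3 ≤ D := le_trans (le_max_right _ _) hD
  have hD3r : (3 : ℝ) ≤ D := by exact_mod_cast hD3
  have hℓ1 : 1 ≤ ell D := (one_lt_ell hD3).le
  have hℓ0 : 0 < ell D := by linarith
  have hP : 0 < bigP D := Real.exp_pos _
  have hlogP : 0 < Real.log (bigP D) := by rw [bigP, Real.log_exp]; positivity
  -- on the block, `n > X ≥ D·P·𝓛^m ≥ P`, so `log n / log P ≥ 1`
  have hXP : bigP D ≤ (X : ℝ) := by
    refine le_trans ?_ hX
    have h1 : (1 : ℝ) ≤ (D : ℝ) * ell D ^ (1056 + 2 * A) := by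
      calc (1 : ℝ) = 1 * 1 := by ring
        _ ≤ (D : ℝ) * ell D ^ (1056 + 2 * A) := mul_le_mul (by linarith) (one_le_pow₀ hℓ1) zero_le_one (by linarith)
    calc bigP D = bigP D * 1 := (mul_one _).symm
      _ ≤ bigP D * ((D : ℝ) * ell D ^ (1056 + 2 * A)) := mul_le_mul_of_nonneg_left h1 hP.le
      _ = (D : ℝ) * bigP D * ell D ^ (1056 + 2 * A) := by ring
  have hz1 : ∀ n ∈ Finset.Ioc X Y, 1 ≤ Real.log n / Real.log (bigP D) := by
    intro n hn
    have hnX : X < n := (Finset.mem_Ioc.mp hn).1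
    have hPn : bigP D ≤ (n : ℝ) := hXP.trans (by exact_mod_cast hnX.le)
    rw [le_div_iff₀ hlogP, one_mul]
    exact Real.log_le_log hP hPn
  set c : ℝ := max (K : ℝ) M with hcdef
  have hM0 : 0 ≤ M := (norm_nonneg _).trans (hM 1 le_rfl)
  have hKc : (K : ℝ) ≤ c := le_max_left _ _
  have hMc : M ≤ c := le_max_right _ _
  rcases eq_or_lt_of_le (hM0.trans hMc) with hc0 | hc0
  · -- `c = 0`: the profile vanishes on `[1, ∞)`, hence on the block
    have hg0 : ∀ z : ℝ, 1 ≤ z → g z = 0 := fun z hz => by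
      have h := (hM z hz).trans hMc
      rw [← hc0] at h
      exact norm_le_zero_iff.mp h
    have hzero : ∑ n ∈ Finset.Ioc X Y, Skeleton.pc χ x n * g (Real.log n / Real.log (Skeleton.bigP D)) *
        (n : ℂ) ^ (-s) = 0 := by
      refine Finset.sum_eq_zero fun n hn => ?_
      rw [hg0 _ (hz1 n hn)]; ring
    rw [hzero, norm_zero, ← hc0]
    simp
  · obtain ⟨hg1, hg1'⟩ := lipschitzOn_normalise' hg (fun z hz => hM z (Set.mem_Ici.mp hz)) hKc hMc hc0
    obtain ⟨hlip, hbd⟩ := maxOne_modification hg1 hg1'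
    have key := hT' x _ hlip hbd s hσ1 hσ2 hsim X Y hX hXY hY
    have hcc : (c : ℂ) * ((c⁻¹ : ℝ) : ℂ) = 1 := by
      rw [Complex.ofReal_inv]; exact mul_inv_cancel₀ (by exact_mod_cast hc0.ne')
    have hsum : ∑ n ∈ Finset.Ioc X Y, Skeleton.pc χ x n * g (Real.log n / Real.log (Skeleton.bigP D)) *
        (n : ℂ) ^ (-s) = (c : ℂ) * ∑ n ∈ Finset.Ioc X Y, Skeleton.pc χ x n *
          (((c⁻¹ : ℝ) : ℂ) * g (max (Real.log n / Real.log (Skeleton.bigP D)) 1)) * (n : ℂ) ^ (-s) := by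
      rw [Finset.mul_sum]
      refine Finset.sum_congr rfl fun n hn => ?_
      rw [max_eq_left (hz1 n hn)]
      calc Skeleton.pc χ x n * g (Real.log n / Real.log (Skeleton.bigP D)) * (n : ℂ) ^ (-s)
          = ((c : ℂ) * ((c⁻¹ : ℝ) : ℂ)) *
            (Skeleton.pc χ x n * g (Real.log n / Real.log (Skeleton.bigP D)) * (n : ℂ) ^ (-s)) := by
            rw [hcc, one_mul]
        _ = _ := by ring
    rw [hsum, norm_mul, Complex.norm_real, Real.norm_of_nonneg hc0.le]
    calc c * ‖∑ n ∈ Finset.Ioc X Y, Skeleton.pc χ x n *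
          (((c⁻¹ : ℝ) : ℂ) * g (max (Real.log n / Real.log (Skeleton.bigP D)) 1)) * (n : ℂ) ^ (-s)‖
        ≤ c * (C * (Skeleton.ell D ^ A)⁻¹) := mul_le_mul_of_nonneg_left key hc0.le
      _ = C * c * (Skeleton.ell D ^ A)⁻¹ := by ring

/-- A sampled zero `ρ ∈ 𝔷(ψ)` has `|Im ρ| ≤ 8t₀`. [cite: Zhang2022LandauSiegel, §2 (2.8), (2.14)] -/
private theorem abs_im_le_of_mem_zeroSet₄ {D : ℕ} (x : Chr D) (hℓ1 : 1 ≤ ell D) {ρ : ℂ}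
    (hρ : ρ ∈ zeroSet D x) : |ρ.im| ≤ 8 * t0 D := by
  have h1 : |ρ.im - 2 * Real.pi * t0 D| < ell1 D := hρ.2.1
  have h2 : ell1 D ≤ t0 D := by
    simp only [ell1, t0]; exact pow_le_pow_right₀ hℓ1 (by norm_num)
  have h3 : 0 ≤ t0 D := by simp only [t0]; positivity
  have hπ : Real.pi < 3.15 := Real.pi_lt_d2
  have hπt : Real.pi * t0 D ≤ 3.15 * t0 D := mul_le_mul_of_nonneg_right hπ.le h3
  have hπt0 : 0 ≤ Real.pi * t0 D := mul_nonneg Real.pi_pos.le h3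
  have h4 := abs_lt.mp h1
  rw [abs_le]; constructor <;> linarith

/-- **Band-scale tail at every sampled zero, class version** (`Re ρ = ½` displayed).
[cite: Zhang2022LandauSiegel, §2 (2.14), (2.30)] [cite: MontgomeryVaughan2007, Thm 9.18] -/
theorem tailInvisible_bandScale_sampled_lipschitzOn {δ : ℝ} (hδ : 0 < δ) (A : ℕ) :
    ∃ C : ℝ, 0 < C ∧ Skeleton.ForAllLarge fun D _ χ =>
      (∀ i ∈ Skeleton.idx χ, (i.2).re = 1 / 2) →
        ∀ (g : ℝ → ℂ) (K : ℝ≥0) (M : ℝ), LipschitzOnWith K g (Set.Ici 1) →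
          (∀ z : ℝ, 1 ≤ z → ‖g z‖ ≤ M) →
          ∀ N₁ N₂ : ℕ, ⌈(D : ℝ) * Skeleton.bigP D * Skeleton.ell D ^ (1056 + 2 * A)⌉₊ + 1 ≤ N₁ → N₁ ≤ N₂ →
            N₂ ≤ ⌈Skeleton.bigP D ^ (1 + δ)⌉₊ →
            ∀ i ∈ Skeleton.idx χ,
              ‖∑ n ∈ Finset.Ico N₁ N₂, Skeleton.pc χ i.1 n * g (Real.log n / Real.log (Skeleton.bigP D)) *
                  (n : ℂ) ^ (-i.2)‖ ≤ C * max (K : ℝ) M * (Skeleton.ell D ^ A)⁻¹ := by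
  obtain ⟨C, hC, D₁, hT⟩ := tailInvisible_bandScale_lipschitzOn hδ A
  refine ⟨C, hC, max D₁ 3, ?_⟩
  intro D _ χ hD hquad hprim hcrit g K M hg hM N₁ N₂ hN₁ hN₁₂ hN₂ i hi
  have hD₁ : D₁ ≤ D := le_trans (le_max_left _ _) hD
  have hD3 : 3 ≤ D := le_trans (le_max_right _ _) hD
  have hT' := hT D χ hD₁ hquad hprim
  have hℓ1 : 1 ≤ ell D := (one_lt_ell hD3).le
  have hP : 0 < bigP D := Real.exp_pos _
  have hlogPpos : 0 < Real.log (bigP D) := by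
    rw [bigP, Real.log_exp]; exact pow_pos (by linarith) 9
  have hi' : i.1 ∈ finsetOf (PsiOne χ) ∧ i.2 ∈ finsetOf (zeroSet D i.1) := by
    simpa only [idx, Finset.mem_sigma] using hi
  have hz : i.2 ∈ zeroSet D i.1 := mem_of_mem_finsetOf hi'.2
  have hre : i.2.re = 1 / 2 := hcrit i hi
  have him : |i.2.im| ≤ 8 * t0 D := abs_im_le_of_mem_zeroSet₄ i.1 hℓ1 hz
  have h1σ : 1 / 2 - 1 / Real.log (bigP D) ≤ i.2.re := by
    rw [hre]; have := one_div_pos.mpr hlogPpos; linarith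
  have h2σ : i.2.re ≤ 2 := by rw [hre]; norm_num
  have hN₁1 : 1 ≤ N₁ := le_trans (Nat.le_add_left 1 _) hN₁
  have hN₂1 : 1 ≤ N₂ := le_trans hN₁1 hN₁₂
  have hXs : N₁ - 1 + 1 = N₁ := Nat.sub_add_cancel hN₁1
  have hYs : N₂ - 1 + 1 = N₂ := Nat.sub_add_cancel hN₂1
  have hXY : N₁ - 1 ≤ N₂ - 1 := Nat.sub_le_sub_right hN₁₂ 1
  have hXr : (D : ℝ) * bigP D * ell D ^ (1056 + 2 * A) ≤ ((N₁ - 1 : ℕ) : ℝ) := by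
    have h1 : ⌈(D : ℝ) * bigP D * ell D ^ (1056 + 2 * A)⌉₊ ≤ N₁ - 1 := by omega
    exact (Nat.le_ceil _).trans (by exact_mod_cast h1)
  have hYr : (((N₂ - 1 : ℕ)) : ℝ) ≤ bigP D ^ (1 + δ) := by
    have hNδ1 : 1 ≤ ⌈bigP D ^ (1 + δ)⌉₊ := Nat.one_le_ceil_iff.mpr (Real.rpow_pos_of_pos hP _)
    have h1 : (((N₂ - 1 : ℕ)) : ℝ) ≤ ((⌈bigP D ^ (1 + δ)⌉₊ - 1 : ℕ) : ℝ) := by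
      exact_mod_cast Nat.sub_le_sub_right hN₂ 1
    refine h1.trans ?_
    rw [Nat.cast_sub hNδ1, Nat.cast_one]
    have := Nat.ceil_lt_add_one (Real.rpow_nonneg hP.le (1 + δ))
    linarith
  have key := hT' i.1 g K M hg hM i.2 h1σ h2σ him (N₁ - 1) (N₂ - 1) hXr hXY hYr
  rw [← hXs, ← hYs, Finset.Ico_add_one_add_one_eq_Ioc]
  exact key

/-! ### Flatness of the discrete mean from the band edge, class version (and the top-vanishing full polynomial) -/

/-- **Flatness of the discrete mean from the band edge for the class `K`-Lipschitz, `‖·‖ ≤ M` on `[1, ∞)`**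
(`0 < δ`, `A : ℕ`): for all large `D`, under the displayed `Re ρ = ½`, for every such `g` and every
`⌈D·P·𝓛^{1058+2A}⌉ + 1 ≤ N₁ ≤ N₂ ≤ ⌈P^{1+δ}⌉`:
`|discMean(N₂) − discMean(N₁)| ≤ 𝓛^{−A}·(discMeanAbs(N₁) + max(K,M)²·discWeight)`.
[cite: Zhang2022LandauSiegel, §2 (2.16)–(2.20), (2.30); §8 Lemma 8.1] -/
theorem discMeanFlat_bandEdge_lipschitzOn (c' : ℝ) {δ : ℝ} (hδ : 0 < δ) (A : ℕ) :
    Skeleton.ForAllLarge fun D _ χ =>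
      (∀ i ∈ Skeleton.idx χ, (i.2).re = 1 / 2) →
        ∀ (g : ℝ → ℂ) (K : ℝ≥0) (M : ℝ), LipschitzOnWith K g (Set.Ici 1) →
          (∀ z : ℝ, 1 ≤ z → ‖g z‖ ≤ M) →
          ∀ N₁ N₂ : ℕ, ⌈(D : ℝ) * Skeleton.bigP D * Skeleton.ell D ^ (1058 + 2 * A)⌉₊ + 1 ≤ N₁ → N₁ ≤ N₂ →
            N₂ ≤ ⌈Skeleton.bigP D ^ (1 + δ)⌉₊ →
            |Repair.discMean c' χ g N₂ - Repair.discMean c' χ g N₁| ≤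
              (Skeleton.ell D ^ A)⁻¹ *
                (Repair.discMeanAbs c' χ g N₁ + max (K : ℝ) M ^ 2 * Repair.discWeight c' χ) := by
  obtain ⟨C, hC, D₁, hT⟩ := tailInvisible_bandScale_sampled_lipschitzOn hδ (A + 1)
  refine ⟨max D₁ (max 3 ⌈Real.exp (2 * C ^ 2)⌉₊), ?_⟩
  intro D _ χ hD hquad hprim hcrit g K M hg hM N₁ N₂ hN₁ hN₁₂ hN₂
  have hD₁ : D₁ ≤ D := le_trans (le_max_left _ _) hD
  have hD3 : 3 ≤ D := le_trans (le_trans (le_max_left _ _) (le_max_right _ _)) hD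
  have hℓC : 2 * C ^ 2 ≤ ell D :=
    le_ell_of_ceil_exp_le₄ (le_trans (le_trans (le_max_right _ _) (le_max_right _ _)) hD)
  have hℓ1 : 1 ≤ ell D := (one_lt_ell hD3).le
  have hℓ0 : 0 < ell D := by linarith
  have h1058 : 1058 + 2 * A = 1056 + 2 * (A + 1) := by ring
  rw [h1058] at hN₁
  have hT' := hT D χ hD₁ hquad hprim hcrit g K M hg hM N₁ N₂ hN₁ hN₁₂ hN₂
  have hN₁1 : 1 ≤ N₁ := le_trans (Nat.le_add_left 1 _) hN₁
  set c : ℝ := max (K : ℝ) M with hcdef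
  set τ : ℝ := C * c * (ell D ^ (A + 1))⁻¹ with hτdef
  set η : ℝ := (ell D ^ A)⁻¹ with hηdef
  have hη : 0 < η := inv_pos.mpr (pow_pos hℓ0 A)
  set t : ((_ : Chr D) × ℂ) → ℂ := fun i =>
    ∑ n ∈ Finset.Ico N₁ N₂, Skeleton.pc χ i.1 n * g (Real.log n / Real.log (Skeleton.bigP D)) *
      (n : ℂ) ^ (-i.2) with htdef
  have hτ : ∀ i ∈ Skeleton.idx χ, ‖t i‖ ≤ τ := fun i hi => hT' i hi
  have hsplit : ∀ i : ((_ : Chr D) × ℂ),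
      Repair.profPoly χ i.1 g N₂ i.2 = Repair.profPoly χ i.1 g N₁ i.2 + t i := by
    intro i
    simp only [Repair.profPoly, htdef]
    rw [← Finset.sum_Ico_consecutive _ hN₁1 hN₁₂]
  have key := abs_sum_mul_norm_sq_perturb_le (Skeleton.idx χ)
    (fun i : ((_ : Chr D) × ℂ) => (cstar c' D i.1 i.2).re * (omegaW D i.2).re)
    (fun i : ((_ : Chr D) × ℂ) => Repair.profPoly χ i.1 g N₁ i.2) t hη hτ
  have hdiff : Repair.discMean c' χ g N₂ - Repair.discMean c' χ g N₁ =
      ∑ i ∈ Skeleton.idx χ, (cstar c' D i.1 i.2).re * (omegaW D i.2).re *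
        (‖Repair.profPoly χ i.1 g N₁ i.2 + t i‖ ^ 2 - ‖Repair.profPoly χ i.1 g N₁ i.2‖ ^ 2) := by
    simp only [Repair.discMean]
    rw [← Finset.sum_sub_distrib]
    refine Finset.sum_congr rfl fun i _ => ?_
    rw [hsplit i]; ring
  have hAbs : Repair.discMeanAbs c' χ g N₁ =
      ∑ i ∈ Skeleton.idx χ, |(cstar c' D i.1 i.2).re * (omegaW D i.2).re| *
        ‖Repair.profPoly χ i.1 g N₁ i.2‖ ^ 2 := rfl
  have hWt : Repair.discWeight c' χ = ∑ i ∈ Skeleton.idx χ, |(cstar c' D i.1 i.2).re * (omegaW D i.2).re| := rfl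
  rw [hdiff, hAbs, hWt]
  refine key.trans ?_
  have hW0 : 0 ≤ ∑ i ∈ Skeleton.idx χ, |(cstar c' D i.1 i.2).re * (omegaW D i.2).re| :=
    Finset.sum_nonneg fun _ _ => abs_nonneg _
  have hcoef : τ ^ 2 / η + τ ^ 2 ≤ c ^ 2 * η := by
    have hA0 : 0 < ell D ^ A := pow_pos hℓ0 A
    have e1 : τ ^ 2 / η = (C * c) ^ 2 / (ell D ^ A * ell D ^ 2) := by
      rw [hτdef, hηdef]; field_simp; ring
    have e2 : τ ^ 2 = (C * c) ^ 2 / (ell D ^ (A + 1)) ^ 2 := by rw [hτdef]; field_simp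
    have hle2 : τ ^ 2 ≤ (C * c) ^ 2 / (ell D ^ A * ell D ^ 2) := by
      rw [e2]
      refine div_le_div_of_nonneg_left (sq_nonneg _) (by positivity) ?_
      have : (ell D ^ (A + 1)) ^ 2 = ell D ^ A * ell D ^ 2 * ell D ^ A := by ring
      rw [this]
      exact le_mul_of_one_le_right (by positivity) (one_le_pow₀ hℓ1)
    have hsum : τ ^ 2 / η + τ ^ 2 ≤ 2 * ((C * c) ^ 2 / (ell D ^ A * ell D ^ 2)) := by rw [e1]; linarith
    refine hsum.trans ?_
    have hre : 2 * ((C * c) ^ 2 / (ell D ^ A * ell D ^ 2)) = c ^ 2 * ((2 * C ^ 2 / ell D ^ 2) * (ell D ^ A)⁻¹) := by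
      field_simp
    rw [hre, hηdef]
    refine mul_le_mul_of_nonneg_left ?_ (sq_nonneg c)
    refine mul_le_of_le_one_left (by positivity) ?_
    rw [div_le_one (by positivity)]
    nlinarith
  have hfin := mul_le_mul_of_nonneg_right hcoef hW0
  have hA0 : 0 ≤ ∑ i ∈ Skeleton.idx χ, |(cstar c' D i.1 i.2).re * (omegaW D i.2).re| *
      ‖Repair.profPoly χ i.1 g N₁ i.2‖ ^ 2 :=
    Finset.sum_nonneg fun _ _ => mul_nonneg (abs_nonneg _) (sq_nonneg _)
  rw [mul_add]
  nlinarith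

/-- **… and for a TOP-VANISHING profile the full polynomial** (`g = 0` on `[θ, ∞)`, `θ ≤ 1 + δ`): the same bound for
EVERY `N₂ ≥ N₁` (no upper limit), `N₁` from the band edge up to `⌈P^{1+δ}⌉`.
[cite: Zhang2022LandauSiegel, §2 (2.16)–(2.20); §8 Lemma 8.1] -/
theorem discMeanFlat_bandEdge_topVanishing (c' : ℝ) {δ : ℝ} (hδ : 0 < δ) (A : ℕ) :
    Skeleton.ForAllLarge fun D _ χ =>
      (∀ i ∈ Skeleton.idx χ, (i.2).re = 1 / 2) →
        ∀ (g : ℝ → ℂ) (K : ℝ≥0) (M : ℝ), LipschitzOnWith K g (Set.Ici 1) →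
          (∀ z : ℝ, 1 ≤ z → ‖g z‖ ≤ M) →
          ∀ θ : ℝ, θ ≤ 1 + δ → (∀ z, θ ≤ z → g z = 0) →
          ∀ N₁ N₂ : ℕ, ⌈(D : ℝ) * Skeleton.bigP D * Skeleton.ell D ^ (1058 + 2 * A)⌉₊ + 1 ≤ N₁ →
            N₁ ≤ ⌈Skeleton.bigP D ^ (1 + δ)⌉₊ → N₁ ≤ N₂ →
            |Repair.discMean c' χ g N₂ - Repair.discMean c' χ g N₁| ≤
              (Skeleton.ell D ^ A)⁻¹ *
                (Repair.discMeanAbs c' χ g N₁ + max (K : ℝ) M ^ 2 * Repair.discWeight c' χ) := by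
  obtain ⟨D₀, h⟩ := discMeanFlat_bandEdge_lipschitzOn c' hδ A
  refine ⟨max D₀ 3, ?_⟩
  intro D _ χ hD hquad hprim hcrit g K M hg hM θ hθ hg0 N₁ N₂ hN₁ hN₁δ hN₁₂
  have h' := h D χ (le_trans (le_max_left _ _) hD) hquad hprim hcrit g K M hg hM
  have hD3 : (3 : ℝ) ≤ D := by exact_mod_cast le_trans (le_max_right _ _) hD
  have hℓ0 : 0 < ell D := Real.log_pos (by linarith)
  have hP : 0 < bigP D := Real.exp_pos _
  have hlogPpos : 0 < Real.log (bigP D) := by rw [bigP, Real.log_exp]; positivity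
  by_cases hNle : N₂ ≤ ⌈bigP D ^ (1 + δ)⌉₊
  · exact h' N₁ N₂ hN₁ hN₁₂ hNle
  · have hNδ : ⌈bigP D ^ (1 + δ)⌉₊ ≤ N₂ := (not_le.mp hNle).le
    have hNδ1 : 1 ≤ ⌈bigP D ^ (1 + δ)⌉₊ := Nat.one_le_ceil_iff.mpr (Real.rpow_pos_of_pos hP _)
    have hpoly : ∀ (x : Chr D) (s : ℂ), Repair.profPoly χ x g N₂ s = Repair.profPoly χ x g ⌈bigP D ^ (1 + δ)⌉₊ s := by
      intro x s
      simp only [Repair.profPoly]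
      rw [← Finset.sum_Ico_consecutive _ hNδ1 hNδ]
      have hzero : ∑ n ∈ Finset.Ico ⌈bigP D ^ (1 + δ)⌉₊ N₂,
          pc χ x n * g (Real.log n / Real.log (bigP D)) * (n : ℂ) ^ (-s) = 0 := by
        refine Finset.sum_eq_zero fun n hn => ?_
        have hn : ⌈bigP D ^ (1 + δ)⌉₊ ≤ n := (Finset.mem_Ico.mp hn).1
        have hnr : bigP D ^ (1 + δ) ≤ (n : ℝ) := (Nat.le_ceil _).trans (by exact_mod_cast hn)
        have hθn : θ ≤ Real.log n / Real.log (bigP D) := by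
          rw [le_div_iff₀ hlogPpos]
          have h1 := Real.log_le_log (Real.rpow_pos_of_pos hP _) hnr
          rw [Real.log_rpow hP] at h1
          calc θ * Real.log (bigP D) ≤ (1 + δ) * Real.log (bigP D) :=
                mul_le_mul_of_nonneg_right hθ hlogPpos.le
            _ ≤ Real.log n := h1
        rw [hg0 _ hθn]; ring
      rw [hzero, add_zero]
    have hmean : Repair.discMean c' χ g N₂ = Repair.discMean c' χ g ⌈bigP D ^ (1 + δ)⌉₊ := by
      simp only [Repair.discMean, hpoly]
    rw [hmean]
    exact h' N₁ _ hN₁ hN₁δ le_rfl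

end Literature.NumberTheory.LFunctions.Zhang2022.KnifeEdgeInvisibleTail

namespace Literature.NumberTheory.LFunctions.Zhang2022

namespace Repair

/-! ### The rows `familySmoothBandEdge`, `familySmoothTopBandEdge` (classes of p457377 unchanged; no slot) -/

/-- **Verdict from the band edge** for a smooth design `(c′, K, M, g)`: for every `δ > 0`, every `A`, eventually under
the displayed `Re ρ = ½`, for every `⌈D·P·𝓛^{1058+2A}⌉ + 1 ≤ N₁ ≤ N₂ ≤ ⌈P^{1+δ}⌉`:
`¬ (𝓛^{−A}·(discMeanAbs N₁ + max(K,M)²·discWeight) < |discMean N₂ − discMean N₁|)`.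
[cite: Zhang2022LandauSiegel, §2 (2.16)–(2.20), (2.30); §8 Lemma 8.1] -/
def SmoothDesign.VerdictBandEdge (d : SmoothDesign) : Prop :=
  ∀ ⦃δ : ℝ⦄, 0 < δ → ∀ A : ℕ, Skeleton.ForAllLarge fun D _ χ =>
    (∀ i ∈ Skeleton.idx χ, (i.2).re = 1 / 2) →
      ∀ N₁ N₂ : ℕ, ⌈(D : ℝ) * Skeleton.bigP D * Skeleton.ell D ^ (1058 + 2 * A)⌉₊ + 1 ≤ N₁ → N₁ ≤ N₂ →
        N₂ ≤ ⌈Skeleton.bigP D ^ (1 + δ)⌉₊ →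
        ¬ ((Skeleton.ell D ^ A)⁻¹ * (discMeanAbs d.c' χ d.g N₁ + max (d.K : ℝ) d.M ^ 2 * discWeight d.c' χ) <
            |discMean d.c' χ d.g N₂ - discMean d.c' χ d.g N₁|)

/-- The slice theorem for the band-edge verdict. [cite: Zhang2022LandauSiegel, §2 (2.16)–(2.20); §8 Lemma 8.1] -/
theorem SmoothDesign.verdictBandEdge_of_inClass (d : SmoothDesign) (h : d.InClass) : d.VerdictBandEdge := by
  intro δ hδ A
  refine (KnifeEdgeInvisibleTail.discMeanFlat_bandEdge_lipschitzOn d.c' hδ A).mono ?_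
  intro D _ χ _ _ hflat hA N₁ N₂ hN₁ hN₁₂ hN₂
  exact not_lt.2 (hflat hA d.g d.K d.M h.1 h.2 N₁ N₂ hN₁ hN₁₂ hN₂)

/-- family «smooth overhang profile, from the TRUE band edge, all pairs of lengths ≤ P^{1+δ}, no slot».
[cite: Zhang2022LandauSiegel, §2 (2.16)–(2.20), (2.30); §8 Lemma 8.1] -/
def familySmoothBandEdge : DesignFamily where
  Design := SmoothDesign
  InClass := SmoothDesign.InClass
  Verdict := SmoothDesign.VerdictBandEdge

/-- **`familySmoothBandEdge` is decided.** [cite: Zhang2022LandauSiegel, §2 (2.16)–(2.20); §8 Lemma 8.1] -/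
theorem familySmoothBandEdge_decided : familySmoothBandEdge.Decided :=
  fun d h => SmoothDesign.verdictBandEdge_of_inClass d h

/-- **Verdict from the band edge, top-vanishing**: the FULL polynomial (every `N₂ ≥ N₁`), `N₁` from the band edge up to
`⌈P^{1+δ}⌉` with `δ := |θ − 1| + 1` (so `θ ≤ 1 + δ`). [cite: Zhang2022LandauSiegel, §2 (2.16)–(2.20); §8 Lemma 8.1] -/
def SmoothTopDesign.VerdictBandEdge (d : SmoothTopDesign) : Prop :=
  ∀ A : ℕ, Skeleton.ForAllLarge fun D _ χ =>
    (∀ i ∈ Skeleton.idx χ, (i.2).re = 1 / 2) →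
      ∀ N₁ N₂ : ℕ, ⌈(D : ℝ) * Skeleton.bigP D * Skeleton.ell D ^ (1058 + 2 * A)⌉₊ + 1 ≤ N₁ →
        N₁ ≤ ⌈Skeleton.bigP D ^ (1 + (|d.θ - 1| + 1))⌉₊ → N₁ ≤ N₂ →
        ¬ ((Skeleton.ell D ^ A)⁻¹ * (discMeanAbs d.c' χ d.g N₁ + max (d.K : ℝ) d.M ^ 2 * discWeight d.c' χ) <
            |discMean d.c' χ d.g N₂ - discMean d.c' χ d.g N₁|)

/-- The slice theorem for the top-vanishing band-edge verdict. [cite: Zhang2022LandauSiegel, §2 (2.16)–(2.20); §8 Lemma 8.1] -/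
theorem SmoothTopDesign.verdictBandEdge_of_inClass (d : SmoothTopDesign) (h : d.InClass) : d.VerdictBandEdge := by
  intro A
  have hδ : 0 < |d.θ - 1| + 1 := by have := abs_nonneg (d.θ - 1); linarith
  have hθ : d.θ ≤ 1 + (|d.θ - 1| + 1) := by have := le_abs_self (d.θ - 1); linarith
  refine (KnifeEdgeInvisibleTail.discMeanFlat_bandEdge_topVanishing d.c' hδ A).mono ?_
  intro D _ χ _ _ hflat hA N₁ N₂ hN₁ hN₁δ hN₁₂
  exact not_lt.2 (hflat hA d.g d.K d.M h.1.1 h.1.2 d.θ hθ h.2 N₁ N₂ hN₁ hN₁δ hN₁₂)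

/-- family «smooth top-vanishing piece, from the TRUE band edge, full polynomial, no slot».
[cite: Zhang2022LandauSiegel, §2 (2.16)–(2.20), (2.30); §8 Lemma 8.1] -/
def familySmoothTopBandEdge : DesignFamily where
  Design := SmoothTopDesign
  InClass := SmoothTopDesign.InClass
  Verdict := SmoothTopDesign.VerdictBandEdge

/-- **`familySmoothTopBandEdge` is decided.** [cite: Zhang2022LandauSiegel, §2 (2.16)–(2.20); §8 Lemma 8.1] -/
theorem familySmoothTopBandEdge_decided : familySmoothTopBandEdge.Decided :=
  fun d h => SmoothTopDesign.verdictBandEdge_of_inClass d h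

/-- C2: the band-edge rows have EXACTLY the classes of `familySmoothLengths` / `familySmoothTop` (p457377), so every
member and every C4 witness of those rows (`inClass_flat`, `inClass_phiTop`, `inClass_glue`) is a member here.
[cite: Zhang2022LandauSiegel, §7 (7.2) p.44] -/
theorem familySmoothBandEdge_inClass_iff (d : SmoothDesign) :
    familySmoothBandEdge.InClass d ↔ familySmoothLengths.InClass d := Iff.rfl

/-- C2 (top-vanishing): same class as `familySmoothTop`. [cite: Zhang2022LandauSiegel, §7 (7.2) p.44] -/
theorem familySmoothTopBandEdge_inClass_iff (d : SmoothTopDesign) :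
    familySmoothTopBandEdge.InClass d ↔ familySmoothTop.InClass d := Iff.rfl

/-- C4: the flat profile is a member (by `inClass_flat`). [cite: Zhang2022LandauSiegel, §7 (7.2) p.44] -/
theorem familySmoothBandEdge_inClass_flat (c' : ℝ) :
    familySmoothBandEdge.InClass (SmoothDesign.mk c' 1 1 fun _ => 1) := inClass_flat c'

/-- **`R⁺⁺`-step of this file**: `ClassDecided (Rplus ++ [familySmoothBandEdge, familySmoothTopBandEdge])`.
[cite: Zhang2022LandauSiegel, §2 (2.32)–(2.33); §7 (7.2) p.44] -/
theorem rplus_smoothBandEdge_decided :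
    ClassDecided (Rplus ++ [familySmoothBandEdge, familySmoothTopBandEdge]) :=
  classDecided_append.2
    ⟨rplus_decided, classDecided_cons familySmoothBandEdge_decided
      (classDecided_cons familySmoothTopBandEdge_decided classDecided_nil)⟩

end Repair

end Literature.NumberTheory.LFunctions.Zhang2022

end
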